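import Literature.AnabelianGeometry.EtaleTheta.Discharge.Sec4NonVacuityCoveringZRoots
import HarnessLib

/-!
# [EtTh] §4 with a COVERING, integral exponents: the price — `B = ℂˣ × t^ℤ` is NOT a monoid on the collapsed base
# (consistency witness, part 7 — honest-limit certificate)

S. Mochizuki, *The geometry of Frobenioids I*, [MochizukiFrdI2008], Def. 1.1 (ii) (a *monoid on `D`*: pull-backs
along FSM-morphisms are bijective), §0 p.14 (FSM-morphisms); *The étale theta function …* [MochizukiEtTh2009],
Def 3.6 (ii) p.77 ("the data `(D, Φ, B, B → Φ^gp)` determines a model Frobenioid", which in [FrdI] Thm 5.2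
presupposes `B` a group-like MONOID ON `D`).

CONSISTENCY WITNESS, TOY — the honest limit of `ToyCovZ` (`Sec4NonVacuityCoveringZ.lean`, p429761), stated in its
header, now kernel-checked.  PROOF-ONLY.  On the one-object base `SingleObj ℕ+` EVERY morphism is an FSM-morphism
(a commutative cancellative monoid: all arrows are mono, and fiberwise surjectivity is commutativity), so a
[FrdI] monoid on that base must have ALL pull-backs bijective; but the pull-back of `B = ℂˣ × t^ℤ` along the
degree-`2` Kummer cover, `(c, n) ↦ (c, 2n)`, misses the uniformiser `t`:

* `ToyCovZ.isFSM_cover` — every Kummer cover `t ↦ t^N` is an FSM-morphism of the collapsed base;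
* `ToyCovZ.not_isMonoidOn_ratFnFunctor` — `B` of `ToyCovZ` is NOT a monoid on the base ([FrdI] Def 1.1 (ii)).

Hence L1's route "[FrdI] Thm 5.2 (ii) ⇒ `C` is a Frobenioid" (`ModelFrobenioid.isFrobenioid`) is unavailable for
`ToyCovZ` — the reason Thm 4.4 (i)/(iii) were certified at the divisible-exponent twin `ToyCov` (p428819) instead.
(In the genuine Kummer tower, covering maps of degree `> 1` are NOT monomorphisms — deck transformations —, so no
such bijectivity is demanded there; the phenomenon is an artefact of collapsing the tower to its endomorphism
monoid.)  Nothing here bears on, or takes a side on, [IUTchIII] Cor. 3.12.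
-/

noncomputable section

namespace Literature.AnabelianGeometry.EtaleTheta

open CategoryTheory Opposite Literature.AlgebraicGeometry.Frobenioids
open scoped NNRat

namespace ToyCovZ

open ToyCov (Base pt deg cover deg_cover hom_eq aut_eq_one epi)

/-- **Every Kummer cover is an FSM-morphism of the collapsed base** ([FrdI] §0: fiberwise surjective — by
commutativity of `ℕ_{≥1}` — and a monomorphism — by cancellation). [cite: MochizukiFrdI2008, §0 p.14] -/
theorem isFSM_cover (A B : Base) (N : ℕ+) : IsFSM (cover A B N) := by
  refine ⟨fun X γ => ⟨X, γ, cover X X N, hom_eq ?_⟩, ⟨fun g h e => hom_eq (mul_left_cancel (e : _ = _))⟩⟩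
  change N * deg γ = deg γ * N
  exact mul_comm _ _

/-- **`B = ℂˣ × t^ℤ` of `ToyCovZ` is NOT a monoid on the base** in the sense of [FrdI] Def 1.1 (ii): the pull-back
along the (FSM) degree-`2` cover is not surjective — the uniformiser `t` is not of the form `c·t^{2n}`.
[cite: MochizukiFrdI2008, Def. 1.1(ii)] -/
theorem not_isMonoidOn_ratFnFunctor : ¬ IsMonoidOn temperedFrobenioid.ratFnFunctor := by
  intro h
  have hsurj := (h.bijective_of_isFSM (cover Aodot.base Aodot.base 2) (isFSM_cover _ _ 2)).2
  -- the uniformiser `t = 1·t¹` on `A_⊙^bs`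
  let z : temperedFrobenioid.divisorMonoid.obj (op Aodot.base) := ⟨Multiplicative.ofAdd (1 : ℚ≥0), trivial⟩
  have hz : realified.divΛ (temperedFrobenioid.baseOp (op Aodot.base))
      (((1 : ℂˣ), Multiplicative.ofAdd (1 : ℤ)) : Fn) =
      temperedFrobenioid.ΦgpToRlog (op Aodot.base) (Algebra.GrothendieckGroup.of z) := by
    change Toy.divHomQ (Multiplicative.ofAdd 1) = gpMap _ (Algebra.GrothendieckGroup.of z)
    rw [Toy.divHomQ_ofAdd_one, gpMap_of]
    rfl
  obtain ⟨q, hq⟩ := hsurj ⟨(((1 : ℂˣ), Multiplicative.ofAdd (1 : ℤ)), Algebra.GrothendieckGroup.of z), hz⟩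
  -- compare the `t`-exponents: `2 n = 1`
  have h1 := congrArg (fun r : temperedFrobenioid.ratFnFunctor.obj (op Aodot.base) => r.1.1.2) hq
  change ((temperedFrobenioid.ratFnPull (cover Aodot.base Aodot.base 2).op q).1).1.2 = Multiplicative.ofAdd (1 : ℤ)
    at h1
  rw [TemperedFrobenioid.coe_ratFnPull] at h1
  change q.1.1.2 ^ (2 : ℕ) = Multiplicative.ofAdd (1 : ℤ) at h1
  have h2 := congrArg Multiplicative.toAdd h1
  rw [toAdd_pow, toAdd_ofAdd, nsmul_eq_mul] at h2
  omega

end ToyCovZ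

end Literature.AnabelianGeometry.EtaleTheta

end
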